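import Mathlib.Analysis.SpecificLimits.Basic
import Mathlib.Topology.Algebra.InfiniteSum.NatInt
import Mathlib.Topology.ExtendFrom
import Mathlib.Topology.MetricSpace.Cauchy
import HarnessLib

/-!
# Continuous extension to the axis `y = 0` from dyadic box estimates

Trunk T-STOCH support (elementary topology). This file isolates the last, purely metric, step of
the proof of Rohde–Schramm's Theorem 3.6 (*Basic properties of SLE*, Ann. Math. 161 (2005),
pp. 897–898), in which the continuity of `H(y, t) = f̂ₜ(iy)` up to `y = 0` is deduced from the
bound `d(j, k) ≤ C(ω) 2^{-jσ}` on the oscillation of `H` over the dyadic boxes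
`R(j, k) = [2^{-j-1}, 2^{-j}] × [k 2^{-2j}, (k+1) 2^{-2j}]`:

> "Let `(y', t')` and `(y'', t'')` be points in `(0,1)²`. Let `j₁` be the smallest integer larger
> than `min{-log₂ y', -log₂ y'', -½ log₂ |t' - t''|}`. Note that a rectangle `R(j₁, k')` that
> intersects the line `t = t'` is adjacent to a rectangle `R(j₁, k'')` that intersects the line
> `t = t''`. Consequently, `|H(y', t') - H(y'', t'')| ≤ ∑_{j ≥ j₁} (d(j, k'ⱼ) + d(j, k''ⱼ))
> ≤ O(1) C(ω) 2^{-σ j₁}` … This shows that for every `t₀ ∈ [0, 1)` the limit of `H(y, t)` as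
> `(y, t) → (0, t₀)` exists, and thereby extends the definition of `H` …"

Here `H : ℝ≥0 × ℝ≥0 → E` (first coordinate `y`, second `t`) takes values in any complete metric
space, the boxes are anchored at their corner `(2^{-j}, k 4^{-j})`, and the extension is
Mathlib's `extendFrom {p | p.1 ≠ 0} H` (the limit within the off-axis set). We prove:

* `RohdeSchramm.modulus_of_box` — box estimates `dist (H(y,t), H(2^{-j}, k 4^{-j})) ≤ D j` on
  `R(j, k)` for `j ≥ j₁`, `k 4^{-j} < T`, with `∑ D j < ∞`, give the uniform modulus near the
  axis: for every `ε > 0` there is `j` with `dist (H(y,t), H(y',t')) ≤ ε` whenever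
  `0 < y, y' ≤ 2^{-j}`, `t, t' < T`, `|t - t'| ≤ 4^{-j}` (the chaining over the levels
  `j, j+1, …` through the common edge points `(2^{-l-1}, t)` of consecutive boxes);
* `RohdeSchramm.exists_tendsto_of_modulus` — the modulus gives the existence of the limit of
  `H` at every axis point `(0, t)`, `t < T`, within the off-axis set (Cauchy along `y = 2^{-n}`,
  completeness);
* `RohdeSchramm.continuousOn_extendFrom_of_modulus` — hence, if `H` is continuous off the axis,
  `extendFrom {p | p.1 ≠ 0} H` is continuous on `{p | p.2 < T}` (Mathlib
  `continuousOn_extendFrom`) and agrees with `H` off the axis (`RohdeSchramm.extendFrom_eq_self`).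

No Loewner theory enters; the analytic box estimate for the Loewner chain is proved separately.

## References

* S. Rohde, O. Schramm, *Basic properties of SLE*, Ann. of Math. 161 (2005), proof of Thm. 3.6,
  pp. 897–898.
* G. F. Lawler, *Conformally Invariant Processes in the Plane*, AMS (2005), Lemma 4.33 and
  Remark 4.30 (the same reduction to a modulus `δ(y + y₁ + |t - s|)`).
-/

noncomputable section

open Set Filter Topology Metric
open scoped NNReal

namespace Literature.Probability.RandomPlanarGeometry

namespace RohdeSchramm

variable {E : Type*} [MetricSpace E] [CompleteSpace E] {H : ℝ≥0 × ℝ≥0 → E} {T : ℝ≥0}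

/-- The off-axis set `{(y, t) | y ≠ 0}` is dense in `[0, ∞) × [0, ∞)`. [folklore] -/
theorem dense_setOf_fst_ne_zero : Dense {p : ℝ≥0 × ℝ≥0 | p.1 ≠ 0} := by
  have hsub : (Ioi (0 : ℝ≥0)) ×ˢ (univ : Set ℝ≥0) ⊆ {p : ℝ≥0 × ℝ≥0 | p.1 ≠ 0} :=
    fun p hp ↦ (mem_Ioi.1 hp.1).ne'
  refine Dense.mono hsub ?_
  rw [dense_iff_closure_eq, closure_prod_eq, closure_univ, closure_Ioi' ⟨1, zero_lt_one⟩]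
  ext p
  simp

/-- Antitonicity of the dyadic scales `2^{-j}` in `ℝ≥0`. [folklore] -/
theorem inv_two_pow_anti {j n : ℕ} (h : j ≤ n) : ((2 : ℝ≥0) ^ n)⁻¹ ≤ ((2 : ℝ≥0) ^ j)⁻¹ := by
  have : ((2 : ℝ) ^ n)⁻¹ ≤ ((2 : ℝ) ^ j)⁻¹ :=
    inv_anti₀ (by positivity) (pow_le_pow_right₀ one_le_two h)
  exact_mod_cast this

/-- The dyadic scales are positive. [folklore] -/
theorem inv_two_pow_pos (n : ℕ) : (0 : ℝ≥0) < ((2 : ℝ≥0) ^ n)⁻¹ := by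
  have : (0 : ℝ) < ((2 : ℝ) ^ n)⁻¹ := by positivity
  exact_mod_cast this

/-- **Existence of the limit at the axis from a uniform modulus** (Rohde–Schramm (2005), proof
of Thm. 3.6, p. 898: "This shows that for every `t₀ ∈ [0,1)` the limit of `H(y,t)` as
`(y,t) → (0,t₀)` exists"). If for every `ε > 0` there is a scale `j` such that
`dist (H(y,t), H(y',t')) ≤ ε` whenever `0 < y, y' ≤ 2^{-j}`, `t, t' < T` and `|t - t'| ≤ 4^{-j}`,
then at every axis point `(0, t)` with `t < T` the function `H` has a limit within the off-axis
set (the sequence `H(2^{-n}, t)` is Cauchy in the complete space `E`, and its limit is the limit).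
[cite: RohdeSchramm2005, Thm 3.6 (proof, p. 898)] -/
theorem exists_tendsto_of_modulus
    (hmod : ∀ ε > 0, ∃ j : ℕ, ∀ y t y' t' : ℝ≥0, 0 < y → y ≤ ((2 : ℝ≥0) ^ j)⁻¹ → 0 < y' →
      y' ≤ ((2 : ℝ≥0) ^ j)⁻¹ → t < T → t' < T → dist t t' ≤ ((4 : ℝ) ^ j)⁻¹ →
      dist (H (y, t)) (H (y', t')) ≤ ε)
    {t : ℝ≥0} (ht : t < T) :
    ∃ c, Tendsto H (𝓝[{p | p.1 ≠ 0}] (0, t)) (𝓝 c) := by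
  -- the sequence along `y = 2^{-n}`
  obtain ⟨u, hu⟩ : ∃ u : ℕ → E, ∀ n, u n = H (((2 : ℝ≥0) ^ n)⁻¹, t) := ⟨_, fun _ ↦ rfl⟩
  have hcauchy : CauchySeq u := by
    refine Metric.cauchySeq_iff'.2 fun ε hε ↦ ?_
    obtain ⟨j, hj⟩ := hmod (ε / 2) (half_pos hε)
    refine ⟨j, fun n hn ↦ ?_⟩
    have := hj _ t _ t (inv_two_pow_pos n) (inv_two_pow_anti hn) (inv_two_pow_pos j) le_rfl
      ht ht (by rw [dist_self]; positivity)
    rw [hu, hu]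
    linarith
  obtain ⟨c, hc⟩ := cauchySeq_tendsto_of_complete hcauchy
  refine ⟨c, Metric.tendsto_nhdsWithin_nhds.2 fun ε hε ↦ ?_⟩
  obtain ⟨j, hj⟩ := hmod (ε / 2) (half_pos hε)
  -- pick `n ≥ j` with `dist (u n) c < ε / 2`
  obtain ⟨n, hnj, hn⟩ : ∃ n, j ≤ n ∧ dist (u n) c < ε / 2 := by
    have h1 : ∀ᶠ n in atTop, dist (u n) c < ε / 2 := (Metric.tendsto_nhds.1 hc) _ (half_pos hε)
    obtain ⟨n, hn1, hn2⟩ := (h1.and (eventually_ge_atTop j)).exists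
    exact ⟨n, hn2, hn1⟩
  have hTt : (0 : ℝ) < T - t := sub_pos.2 (by exact_mod_cast ht)
  refine ⟨min (((2 : ℝ) ^ j)⁻¹) (min (((4 : ℝ) ^ j)⁻¹) ((T : ℝ) - t)),
    lt_min (by positivity) (lt_min (by positivity) hTt), fun p hpA hpd ↦ ?_⟩
  rw [Prod.dist_eq, max_lt_iff] at hpd
  obtain ⟨hp1, hp2⟩ := hpd
  have hp1' : (p.1 : ℝ) < ((2 : ℝ) ^ j)⁻¹ := by
    have h := hp1.trans_le (min_le_left _ _)
    rwa [NNReal.dist_eq, NNReal.coe_zero, sub_zero, abs_of_nonneg p.1.coe_nonneg] at h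
  have hy'pos : 0 < p.1 := pos_iff_ne_zero.2 hpA
  have hy'le : p.1 ≤ ((2 : ℝ≥0) ^ j)⁻¹ := by
    have : (p.1 : ℝ) ≤ ((2 : ℝ) ^ j)⁻¹ := hp1'.le
    exact_mod_cast this
  have ht' : p.2 < T := by
    have h2 : dist p.2 t < (T : ℝ) - t :=
      hp2.trans_le ((min_le_right _ _).trans (min_le_right _ _))
    rw [NNReal.dist_eq] at h2
    have : (p.2 : ℝ) < T := by linarith [le_abs_self ((p.2 : ℝ) - t)]
    exact_mod_cast this
  have hdist : dist t p.2 ≤ ((4 : ℝ) ^ j)⁻¹ := by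
    rw [dist_comm]
    exact (hp2.trans_le ((min_le_right _ _).trans (min_le_left _ _))).le
  have key := hj _ t p.1 p.2 (inv_two_pow_pos n) (inv_two_pow_anti hnj) hy'pos hy'le ht ht' hdist
  rw [← hu, Prod.mk.eta] at key
  calc dist (H p) c ≤ dist (H p) (u n) + dist (u n) c := dist_triangle _ _ _
    _ < ε / 2 + ε / 2 := by
        rw [dist_comm] at key
        linarith
    _ = ε := add_halves ε

/-- **Continuity of the extension to the axis.** If `H` is continuous off the axis and has the
uniform modulus of `exists_tendsto_of_modulus` below the level `T`, then Mathlib's extension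
`extendFrom {p | p.1 ≠ 0} H` (the limit within the off-axis set) is continuous on
`{p | p.2 < T}`. Rohde–Schramm (2005), proof of Thm. 3.6, p. 898 ("… and thereby extends the
definition of `H` to `[0, ∞) × [0, 1)`. Since `H` is clearly continuous in `(0, ∞) × [0, t)`,
the proof is now complete"). [cite: RohdeSchramm2005, Thm 3.6 (proof, p. 898)] -/
theorem continuousOn_extendFrom_of_modulus (hcont : ∀ p : ℝ≥0 × ℝ≥0, p.1 ≠ 0 → ContinuousAt H p)
    (hmod : ∀ ε > 0, ∃ j : ℕ, ∀ y t y' t' : ℝ≥0, 0 < y → y ≤ ((2 : ℝ≥0) ^ j)⁻¹ → 0 < y' →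
      y' ≤ ((2 : ℝ≥0) ^ j)⁻¹ → t < T → t' < T → dist t t' ≤ ((4 : ℝ) ^ j)⁻¹ →
      dist (H (y, t)) (H (y', t')) ≤ ε) :
    ContinuousOn (extendFrom {p | p.1 ≠ 0} H) {p | p.2 < T} := by
  refine continuousOn_extendFrom (fun p _ ↦ ?_) (fun p hp ↦ ?_)
  · rw [dense_setOf_fst_ne_zero.closure_eq]
    exact mem_univ _
  · by_cases h : p.1 = 0
    · have hp' : p = (0, p.2) := Prod.ext h rfl
      rw [hp']
      exact exists_tendsto_of_modulus hmod hp
    · exact ⟨H p, (hcont p h).continuousWithinAt.tendsto⟩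

omit [CompleteSpace E] in
/-- Off the axis the extension is the function itself (for `H` continuous off the axis; Mathlib
`extendFrom_extends`). [folklore] -/
theorem extendFrom_eq_self (hcont : ∀ p : ℝ≥0 × ℝ≥0, p.1 ≠ 0 → ContinuousAt H p)
    {p : ℝ≥0 × ℝ≥0} (hp : p.1 ≠ 0) : extendFrom {p | p.1 ≠ 0} H p = H p :=
  extendFrom_extends (fun q hq ↦ (hcont q hq).continuousWithinAt) p hp

/-- The dyadic time anchor: `⌊t 4ʲ⌋ 4^{-j} ≤ t ≤ (⌊t 4ʲ⌋ + 1) 4^{-j}`. [folklore] -/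
theorem floor_anchor (t : ℝ≥0) (j : ℕ) :
    ((⌊(t : ℝ) * 4 ^ j⌋₊ : ℝ≥0)) / 4 ^ j ≤ t ∧ t ≤ ((⌊(t : ℝ) * 4 ^ j⌋₊ : ℝ≥0) + 1) / 4 ^ j := by
  rw [← NNReal.coe_le_coe, ← NNReal.coe_le_coe]
  push_cast
  constructor
  · rw [div_le_iff₀ (by positivity)]
    exact Nat.floor_le (by positivity)
  · rw [le_div_iff₀ (by positivity)]
    exact (Nat.lt_floor_add_one _).le

/-- Every `0 < y ≤ 2^{-j}` lies in a dyadic band `[2^{-(j+n)-1}, 2^{-(j+n)}]`. [folklore] -/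
theorem exists_dyadic_band {y : ℝ≥0} {j : ℕ} (hy0 : 0 < y) (hy : y ≤ ((2 : ℝ≥0) ^ j)⁻¹) :
    ∃ n, ((2 : ℝ≥0) ^ (j + n + 1))⁻¹ ≤ y ∧ y ≤ ((2 : ℝ≥0) ^ (j + n))⁻¹ := by
  have hx0 : (0 : ℝ) < y * 2 ^ j := by positivity
  have hy' : (y : ℝ) ≤ ((2 : ℝ) ^ j)⁻¹ := by exact_mod_cast hy
  have hx1 : (y : ℝ) * 2 ^ j ≤ 1 := by
    calc (y : ℝ) * 2 ^ j ≤ ((2 : ℝ) ^ j)⁻¹ * 2 ^ j := by gcongr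
      _ = 1 := inv_mul_cancel₀ (by positivity)
  obtain ⟨n, hn1, hn2⟩ := exists_nat_pow_near_of_lt_one hx0 hx1
    (by norm_num : (0 : ℝ) < 1 / 2) (by norm_num : (1 : ℝ) / 2 < 1)
  rw [one_div, inv_pow] at hn1 hn2
  refine ⟨n, ?_, ?_⟩
  · have g1 : ((2 : ℝ) ^ (j + n + 1))⁻¹ ≤ y := by
      rw [inv_eq_one_div, div_le_iff₀ (by positivity)]
      have := (inv_lt_iff_one_lt_mul₀ (by positivity)).1 hn1
      calc (1 : ℝ) ≤ y * 2 ^ j * 2 ^ (n + 1) := this.le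
        _ = y * 2 ^ (j + n + 1) := by ring
    exact_mod_cast g1
  · have g2 : (y : ℝ) ≤ ((2 : ℝ) ^ (j + n))⁻¹ := by
      rw [inv_eq_one_div, le_div_iff₀ (by positivity)] at hn2 ⊢
      calc (y : ℝ) * 2 ^ (j + n) = y * 2 ^ j * 2 ^ n := by ring
        _ ≤ 1 := hn2
    exact_mod_cast g2

omit [CompleteSpace E] in
/-- **From box estimates to the uniform modulus** (Rohde–Schramm (2005), proof of Thm. 3.6,
p. 898). Suppose that for every level `j ≥ j₁` and every box
`R(j, k) = [2^{-j-1}, 2^{-j}] × [k 4^{-j}, (k+1) 4^{-j}]` anchored below the level `T`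
(`k 4^{-j} < T`) the values of `H` on the box are within `D j` of the corner value
`H(2^{-j}, k 4^{-j})`, where `D ≥ 0` is summable. Then for every `ε > 0` there is `j` such that
`dist (H(y,t), H(y',t')) ≤ ε` for all `0 < y, y' ≤ 2^{-j}`, `t, t' < T`, `|t - t'| ≤ 4^{-j}`:
chain from `(y, t)` up through the levels to the corner of the level-`j` box (consecutive
corners are compared through the common edge point `(2^{-l-1}, t)`, costing `D l + D (l+1)`),
across to the (equal or adjacent) level-`j` box of `t'`, and down to `(y', t')`; the total is at
most `4 ∑_{l ≥ j} D l`. [cite: RohdeSchramm2005, Thm 3.6 (proof, p. 898)] -/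
theorem modulus_of_box {D : ℕ → ℝ} (hD : Summable D) (hD0 : ∀ j, 0 ≤ D j) {j₁ : ℕ}
    (hbox : ∀ j, j₁ ≤ j → ∀ k : ℕ, (k : ℝ≥0) / 4 ^ j < T → ∀ y t : ℝ≥0,
      ((2 : ℝ≥0) ^ (j + 1))⁻¹ ≤ y → y ≤ ((2 : ℝ≥0) ^ j)⁻¹ → (k : ℝ≥0) / 4 ^ j ≤ t →
      t ≤ ((k : ℝ≥0) + 1) / 4 ^ j →
      dist (H (y, t)) (H (((2 : ℝ≥0) ^ j)⁻¹, (k : ℝ≥0) / 4 ^ j)) ≤ D j) :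
    ∀ ε > 0, ∃ j : ℕ, ∀ y t y' t' : ℝ≥0, 0 < y → y ≤ ((2 : ℝ≥0) ^ j)⁻¹ → 0 < y' →
      y' ≤ ((2 : ℝ≥0) ^ j)⁻¹ → t < T → t' < T → dist t t' ≤ ((4 : ℝ) ^ j)⁻¹ →
      dist (H (y, t)) (H (y', t')) ≤ ε := by
  -- tails of `D`
  obtain ⟨Tl, hTl⟩ : ∃ Tl : ℕ → ℝ, ∀ j, Tl j = ∑' l, D (l + j) := ⟨_, fun _ ↦ rfl⟩
  have hTl_succ : ∀ j, Tl j = D j + Tl (j + 1) := by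
    intro j
    have hs : Summable (fun l ↦ D (l + j)) := (summable_nat_add_iff j).2 hD
    rw [hTl, hTl, hs.tsum_eq_zero_add, zero_add]
    congr 1
    exact tsum_congr fun l ↦ by rw [Nat.add_right_comm, Nat.add_assoc]
  have hTl0 : ∀ j, 0 ≤ Tl j := fun j ↦ by rw [hTl]; exact tsum_nonneg fun l ↦ hD0 _
  have hDle : ∀ j, D j ≤ Tl j := fun j ↦ by rw [hTl_succ j]; linarith [hTl0 (j + 1)]
  have hTlto : Tendsto Tl atTop (𝓝 0) := by
    have := tendsto_sum_nat_add D
    refine this.congr fun j ↦ (hTl j).symm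
  -- the time anchors `k_j(t) = ⌊t 4ʲ⌋` and the corner values `A j t = H (2^{-j}, k_j(t) 4^{-j})`
  obtain ⟨kf, hkf⟩ : ∃ kf : ℕ → ℝ≥0 → ℕ, ∀ j t, kf j t = ⌊(t : ℝ) * 4 ^ j⌋₊ :=
    ⟨_, fun _ _ ↦ rfl⟩
  have hk1 : ∀ j t, ((kf j t : ℕ) : ℝ≥0) / 4 ^ j ≤ t := fun j t ↦ by
    rw [hkf]; exact (floor_anchor t j).1
  have hk2 : ∀ j t, t ≤ (((kf j t : ℕ) : ℝ≥0) + 1) / 4 ^ j := fun j t ↦ by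
    rw [hkf]; exact (floor_anchor t j).2
  have hk3 : ∀ j (t : ℝ≥0), t < T → ((kf j t : ℕ) : ℝ≥0) / 4 ^ j < T :=
    fun j t ht ↦ (hk1 j t).trans_lt ht
  obtain ⟨A, hA⟩ : ∃ A : ℕ → ℝ≥0 → E, ∀ j t,
      A j t = H (((2 : ℝ≥0) ^ j)⁻¹, ((kf j t : ℕ) : ℝ≥0) / 4 ^ j) := ⟨_, fun _ _ ↦ rfl⟩
  -- the point of the box `R(j, k_j(t))` at height `y` and time `t` is `D j`-close to the corner
  have hboxA : ∀ j, j₁ ≤ j → ∀ t : ℝ≥0, t < T → ∀ y : ℝ≥0, ((2 : ℝ≥0) ^ (j + 1))⁻¹ ≤ y →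
      y ≤ ((2 : ℝ≥0) ^ j)⁻¹ → dist (H (y, t)) (A j t) ≤ D j := by
    intro j hj t ht y hy1 hy2
    rw [hA]
    exact hbox j hj (kf j t) (hk3 j t ht) y t hy1 hy2 (hk1 j t) (hk2 j t)
  -- vertical chaining through the levels `j, j+1, …, j+n`
  have vert : ∀ n j, j₁ ≤ j → ∀ t : ℝ≥0, t < T → ∀ y : ℝ≥0,
      ((2 : ℝ≥0) ^ (j + n + 1))⁻¹ ≤ y → y ≤ ((2 : ℝ≥0) ^ (j + n))⁻¹ →
      dist (H (y, t)) (A j t) ≤ 2 * Tl j - D j := by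
    intro n
    induction n with
    | zero =>
      intro j hj t ht y hy1 hy2
      have hb := hboxA j hj t ht y (by simpa using hy1) (by simpa using hy2)
      linarith [hDle j]
    | succ n ih =>
      intro j hj t ht y hy1 hy2
      have h1 := ih (j + 1) (Nat.le_succ_of_le hj) t ht y
        (by rwa [show j + 1 + n + 1 = j + (n + 1) + 1 by ring])
        (by rwa [show j + 1 + n = j + (n + 1) by ring])
      -- the common edge point `q = (2^{-j-1}, t)` of the boxes at levels `j` and `j + 1`
      have hq1 : dist (H (((2 : ℝ≥0) ^ (j + 1))⁻¹, t)) (A j t) ≤ D j :=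
        hboxA j hj t ht _ le_rfl (inv_two_pow_anti (Nat.le_succ j))
      have hq2 : dist (H (((2 : ℝ≥0) ^ (j + 1))⁻¹, t)) (A (j + 1) t) ≤ D (j + 1) :=
        hboxA (j + 1) (Nat.le_succ_of_le hj) t ht _ (inv_two_pow_anti (Nat.le_succ _)) le_rfl
      calc dist (H (y, t)) (A j t)
          ≤ dist (H (y, t)) (A (j + 1) t) + dist (A (j + 1) t) (A j t) := dist_triangle _ _ _
        _ ≤ (2 * Tl (j + 1) - D (j + 1)) + (D (j + 1) + D j) := by
            refine add_le_add h1 ?_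
            calc dist (A (j + 1) t) (A j t)
                ≤ dist (A (j + 1) t) (H (((2 : ℝ≥0) ^ (j + 1))⁻¹, t)) +
                    dist (H (((2 : ℝ≥0) ^ (j + 1))⁻¹, t)) (A j t) := dist_triangle _ _ _
              _ ≤ D (j + 1) + D j := add_le_add (by rwa [dist_comm]) hq1
        _ = 2 * Tl j - D j := by rw [hTl_succ j]; ring
  -- all heights `0 < y ≤ 2^{-j}` at once
  have vert' : ∀ j, j₁ ≤ j → ∀ t : ℝ≥0, t < T → ∀ y : ℝ≥0, 0 < y → y ≤ ((2 : ℝ≥0) ^ j)⁻¹ →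
      dist (H (y, t)) (A j t) ≤ 2 * Tl j - D j := by
    intro j hj t ht y hy0 hy
    obtain ⟨n, hn1, hn2⟩ := exists_dyadic_band hy0 hy
    exact vert n j hj t ht y hn1 hn2
  -- horizontal step: the corners of the level-`j` boxes of `t ≤ t'`, `|t - t'| ≤ 4^{-j}`
  have horiz : ∀ j, j₁ ≤ j → ∀ t t' : ℝ≥0, t ≤ t' → t' < T → dist t t' ≤ ((4 : ℝ) ^ j)⁻¹ →
      dist (A j t) (A j t') ≤ D j := by
    intro j hj t t' htt' ht' hd
    have hmono : kf j t ≤ kf j t' := by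
      rw [hkf, hkf]
      exact Nat.floor_le_floor (by gcongr)
    have hle : kf j t' ≤ kf j t + 1 := by
      have h1 : (t' : ℝ) ≤ t + ((4 : ℝ) ^ j)⁻¹ := by
        rw [NNReal.dist_eq, abs_sub_comm, abs_of_nonneg (by simpa using htt')] at hd
        linarith
      have h2 : (t' : ℝ) * 4 ^ j ≤ t * 4 ^ j + 1 := by
        calc (t' : ℝ) * 4 ^ j ≤ (t + ((4 : ℝ) ^ j)⁻¹) * 4 ^ j := by gcongr
          _ = t * 4 ^ j + 1 := by field_simp
      rw [hkf, hkf]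
      calc ⌊(t' : ℝ) * 4 ^ j⌋₊ ≤ ⌊(t : ℝ) * 4 ^ j + 1⌋₊ := Nat.floor_le_floor h2
        _ = ⌊(t : ℝ) * 4 ^ j⌋₊ + 1 := Nat.floor_add_one (by positivity)
    rcases Nat.eq_or_lt_of_le hmono with heq | hlt
    · rw [hA, hA, heq, dist_self]
      exact hD0 j
    · have heq : kf j t' = kf j t + 1 := le_antisymm hle hlt
      have ht : t < T := htt'.trans_lt ht'
      have hb := hbox j hj (kf j t) (hk3 j t ht) (((2 : ℝ≥0) ^ j)⁻¹)
        ((((kf j t : ℕ) : ℝ≥0) + 1) / 4 ^ j) (inv_two_pow_anti (Nat.le_succ j)) le_rfl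
        (by gcongr; exact le_self_add) le_rfl
      rw [dist_comm, hA, hA, heq]
      push_cast
      exact hb
  -- conclusion
  intro ε hε
  obtain ⟨j₂, hj₂⟩ : ∃ j₂, ∀ j, j₂ ≤ j → Tl j < ε / 4 := by
    obtain ⟨j₂, h⟩ := eventually_atTop.1 ((Metric.tendsto_nhds.1 hTlto) (ε / 4) (by positivity))
    refine ⟨j₂, fun j hj ↦ ?_⟩
    have := h j hj
    rwa [Real.dist_eq, sub_zero, abs_of_nonneg (hTl0 j)] at this
  have main : ∀ y t y' t' : ℝ≥0, 0 < y → y ≤ ((2 : ℝ≥0) ^ max j₁ j₂)⁻¹ → 0 < y' →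
      y' ≤ ((2 : ℝ≥0) ^ max j₁ j₂)⁻¹ → t < T → t' < T → t ≤ t' →
      dist t t' ≤ ((4 : ℝ) ^ max j₁ j₂)⁻¹ → dist (H (y, t)) (H (y', t')) ≤ ε := by
    intro y t y' t' hy0 hy hy0' hy' ht ht' htt' hd
    have h1 := vert' _ (le_max_left _ _) t ht y hy0 hy
    have h2 := vert' _ (le_max_left _ _) t' ht' y' hy0' hy'
    have h3 := horiz _ (le_max_left _ _) t t' htt' ht' hd
    have h4 := hj₂ _ (le_max_right j₁ j₂)
    have h5 := hD0 (max j₁ j₂)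
    calc dist (H (y, t)) (H (y', t'))
        ≤ dist (H (y, t)) (A _ t) + dist (A _ t) (A _ t') + dist (A (max j₁ j₂) t') (H (y', t')) :=
          dist_triangle4 _ _ _ _
      _ ≤ (2 * Tl _ - D _) + D _ + (2 * Tl _ - D _) := by
          rw [dist_comm (A _ t')]
          exact add_le_add (add_le_add h1 h3) h2
      _ ≤ ε := by linarith
  refine ⟨max j₁ j₂, fun y t y' t' hy0 hy hy0' hy' ht ht' hd ↦ ?_⟩
  rcases le_total t t' with h | h
  · exact main y t y' t' hy0 hy hy0' hy' ht ht' h hd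
  · rw [dist_comm]
    exact main y' t' y t hy0' hy' hy0 hy ht' ht h (by rwa [dist_comm])

end RohdeSchramm

end Literature.Probability.RandomPlanarGeometry
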